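import Summits.CriticalPhenomena.PercolationContinuityZ3.Theorems.Transplant.BoxProdZ2DeepRoute
import HarnessLib

/-!
# The first hop of a chain from a seed AT THE TUBE CENTRE (v3′ = entry-seed anchoring, lead V51 / ENTRY-SEED-STAR.md §3 (D2)): the link from the
# inner fat prism around a fibre centre `c` to the fat orthant face at planar scale `ℓ`, inside the fat prism of scale `ℓ`, has probability
# `> 1 - δ²` under any subbox weighting of the tube graph whose region contains that prism (Lemma 9-prod at the centre, transported by a frame)

builds on p205010 (kernel theorem, internal audit signed; external expert review pending) — nothing in this file uses p205010.
Lane `prim-bschramm`, seat `prim-bschramm-p3`; helper file (`--supports stmt-CriticalPhenomena-4575 --as helper`).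

This is the body of `deep_h3` without the contact bookkeeping (no `pwin`/`fibCtrT`/`kitCube`): the centre `c` is arbitrary (the entry seed's
fibre centre `γ`), the planar centre `v` arbitrary, the frame `γ' : X ≃g X` with `γ' c ∈ V₀` supplies the representative `τ = γ' c`.
* `link_frameSeq_center` — `1 - δ² < P_{Wt}(linkIn (frameSeq ℓ) (frameSeq (msel τ)) (frame(B_X(τ, ψ ℓ) × orthantFace a τ' ℓ)))`;
* `link_seed_center` — the same with any source set `Sd ⊇ frameSeq (msel τ)` (e.g. the WIRED entry seed cube) and any target
  `T ⊇` the fat orthant face (monotonicity of `linkIn`).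

[cite: KozmaNitzan2024, §4 Lemma 9 (p. 16), Lemma 11 (p. 23: the first face from the wired cube) — the ℤ^d model]
-/

noncomputable section

open MeasureTheory

namespace Summit.CriticalPhenomena.PercolationContinuityZ3.Theorems

namespace Transplant

namespace BoxProdZ2

open Literature.Probability.Percolation Literature.Probability.LatticeModels SimpleGraph KNLevels KozmaNitzan
open Literature.Probability.Percolation.GM
open Literature.Barriers.CriticalPhenomena (graphBall graphBall_finite mem_graphBall_self graphBall_mono)

variable {W : Type} [DecidableEq W] (X : SimpleGraph W) [X.LocallyFinite]

/-- **The first hop from a centred seed** (Lemma 9-prod at the centre, transported): for a centre `c`, frame `γ'` with `γ' c ∈ V₀`, planar centre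
`v`, scale `ℓ`, the link clause of `exists_scales` at scale `ℓ`, a subbox weighting `Wt` of the tube graph over `π = B_X(xe, Rw)` on `D`, and
`frameSeq ℓ ⊆ D` with fibres in `π`: the inner fat prism is linked inside the prism of scale `ℓ` to the fat orthant face `(a, τ')` with
`P_{Wt} > 1 - δ²`. [cite: KozmaNitzan2024, §4 Lemma 9 (p. 16), p. 23] -/
theorem link_frameSeq_center [Countable W] {p : unitInterval} (hT : TubeSubcritical X p) (V₀ : Finset W) {δ : ℝ} {msel : W → ℕ} {ℓ : ℕ}
    (hlink : ∀ τ ∈ V₀, ∀ g : HOct 2, 1 - δ ^ 2 < (bondPercolation (X □ zdGraph 2) p).real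
      (linkIn (↑(ufatSeq X hT V₀ τ ℓ)) (ufatSeq X hT V₀ τ (msel τ)) (ballFin X τ (ufatRadius X hT V₀ ℓ) ×ˢ piece g ℓ)))
    {xe : W} {Rw : ℕ} {Wt : Sym2 (W × Site 2) → unitInterval} {D : Finset (W × Site 2)}
    (hWD : IsSubbox (tubeGraph X (ballFin X xe Rw)) Wt p D) {c : W} (γ' : X ≃g X) (hγ : γ' c ∈ V₀) (v : Site 2)
    (hQD : frameSeq X hT V₀ γ' v (γ' c) ℓ ⊆ D) (hQπ : ∀ u ∈ frameSeq X hT V₀ γ' v (γ' c) ℓ, u.1 ∈ ballFin X xe Rw)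
    (a : Fin 2) (τ' : Fin 2 → ℤˣ) :
    1 - δ ^ 2 < (prodBernoulli Wt).real (linkIn (↑(frameSeq X hT V₀ γ' v (γ' c) ℓ)) (frameSeq X hT V₀ γ' v (γ' c) (msel (γ' c)))
      ((ballFin X (γ' c) (ufatRadius X hT V₀ ℓ) ×ˢ orthantFace a τ' ℓ).image (prodFrameIso X γ'.symm v))) := by
  set τ := γ' c with hτ
  rw [real_cubeEvent_eq X hWD hQD hQπ (determinedBy_linkIn _ _ _ le_rfl) (measurableSet_linkIn _ _ _)]
  have h := real_linkIn_image_iso (G := X □ zdGraph 2) (prodFrameIso X γ'.symm v) p (ufatSeq X hT V₀ τ ℓ) (ufatSeq X hT V₀ τ (msel τ))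
    (ballFin X τ (ufatRadius X hT V₀ ℓ) ×ˢ orthantFace a τ' ℓ)
  change 1 - δ ^ 2 < (bondPercolation (X □ zdGraph 2) p).real (linkIn (↑((ufatSeq X hT V₀ τ ℓ).image (prodFrameIso X γ'.symm v)))
    ((ufatSeq X hT V₀ τ (msel τ)).image (prodFrameIso X γ'.symm v))
    ((ballFin X τ (ufatRadius X hT V₀ ℓ) ×ˢ orthantFace a τ' ℓ).image (prodFrameIso X γ'.symm v)))
  rw [h, product_orthantFace_eq_piece]
  exact hlink τ hγ _

/-- **From a (wired) seed containing the inner fat prism to a target containing the fat face**: monotone corollary of `link_frameSeq_center`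
(`linkIn` grows with the source and target sets). [cite: KozmaNitzan2024, §4 Lemma 11 (p. 23)] -/
theorem link_seed_center [Countable W] {p : unitInterval} (hT : TubeSubcritical X p) (V₀ : Finset W) {δ : ℝ} {msel : W → ℕ} {ℓ : ℕ}
    (hlink : ∀ τ ∈ V₀, ∀ g : HOct 2, 1 - δ ^ 2 < (bondPercolation (X □ zdGraph 2) p).real
      (linkIn (↑(ufatSeq X hT V₀ τ ℓ)) (ufatSeq X hT V₀ τ (msel τ)) (ballFin X τ (ufatRadius X hT V₀ ℓ) ×ˢ piece g ℓ)))
    {xe : W} {Rw : ℕ} {Wt : Sym2 (W × Site 2) → unitInterval} {D : Finset (W × Site 2)}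
    (hWD : IsSubbox (tubeGraph X (ballFin X xe Rw)) Wt p D) {c : W} (γ' : X ≃g X) (hγ : γ' c ∈ V₀) (v : Site 2)
    (hQD : frameSeq X hT V₀ γ' v (γ' c) ℓ ⊆ D) (hQπ : ∀ u ∈ frameSeq X hT V₀ γ' v (γ' c) ℓ, u.1 ∈ ballFin X xe Rw)
    (a : Fin 2) (τ' : Fin 2 → ℤˣ) {Sd T : Finset (W × Site 2)} (hSd : frameSeq X hT V₀ γ' v (γ' c) (msel (γ' c)) ⊆ Sd)
    (hTt : (ballFin X (γ' c) (ufatRadius X hT V₀ ℓ) ×ˢ orthantFace a τ' ℓ).image (prodFrameIso X γ'.symm v) ⊆ T) :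
    1 - δ ^ 2 < (prodBernoulli Wt).real (linkIn (↑(frameSeq X hT V₀ γ' v (γ' c) ℓ)) Sd T) :=
  (link_frameSeq_center X hT V₀ hlink hWD γ' hγ v hQD hQπ a τ').trans_le
    (measureReal_mono (linkIn_mono le_rfl hSd hTt) (measure_ne_top _ _))

end BoxProdZ2

end Transplant

end Summit.CriticalPhenomena.PercolationContinuityZ3.Theorems

end
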